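import Summits.QuantumFields.BalabanUV.Beta.SymCorrectorRest
import Summits.QuantumFields.BalabanUV.Beta.GAN24.SecondOrderReadersParity

/-!
# `BalabanUV.Beta.GAN24.SlotTransportParity` — row G-an2-4 at (III′), the S-∕W-SLOT TRANSPORT `𝒯` (d1-formalise-leaf-03's `SymCorrectorFace.slotPsiS` ∕ `faceSum`):
# **THE SLOT TRANSPORT COMMUTES WITH THE ROW-PARITY INVOLUTION `P := sgnK ∘ trK`** — so it maps the even ∕ odd halves of a bond family to the even ∕ odd
# halves of its transport and preserves row-parity-odd (and -even) families — the TRANSPORT-side complement of road-P2 g55's face-sum file `CombSlotTransportFaceWard`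
# (G-an2-4 formalisation swarm, leaf-01 gen 79; the first sentence of the OWNER gan24-p1 g46's question (Q2), NOTE N-gan24p1-g46-1 l.65048)

HONEST DEPENDENCY (page 1, mandatory): continuum YM on T⁴ ⇐ BetaPertH ∧ nine spine estimates (0/9 proved); BetaPertH ⇐ (D1) ∧ (D4) ∧
CAP+tail; G-an2-4 gates asym, D1 and NE2/3/4.  HONEST FRAMING (cell contract, verbatim): «discharging `BetaPertH` makes Bałaban's UV
stability UNCONDITIONAL — a real constructive-QFT result; it is NOT the continuum limit and NOT the Clay problem.»  THIS MODULE DISCHARGES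
NOTHING of the wall and NOTHING of row D1: [folklore] finite-sum bookkeeping BY NAME over d1-formalise-leaf-03's `faceSum` ∕ `slotPsiS` (`SymCorrectorFace`; linearity `SymCorrectorRest.faceSum_add ∕ _smul`) and
gan24-leaf-03's linearity lemmas of the involution (`SecondOrderReadersParity.sgnK_trK_add ∕ _smul ∕ _sum ∕ _neg`, `parityOdd_iff`).  No `def`, no `Prop` minted, nothing
printed asserted, 0 sorry.  It answers NOTHING of (Q2) («is the face part of `𝒯` null or contracting on the even tower's class?» — leaf-06 ∕ road-P2 ∕ leaf-03's
first refusal); it records only that the question is WELL POSED half by half: `𝒯` does not mix the parity halves.  NEVER «G-an2-4 closed» as (CONV-C); NOT D1,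
NOT `BetaPertH`, NOT continuum, NOT Clay.

ABSOLUTE RULE (cell charter, verbatim): «No internally-minted statement may enter as a cited fact. Every hypothesis is either kernel-proved in
this package or a verbatim quotation of a PUBLISHED theorem with page reference. The manuscript(s) under audit are NOT citable for their own
disputed steps — they are the thing under adjudication; programme-internal (2001/route/tribunal) claims are never citable.»  Nothing is cited here.

## Why (context only; asserted nowhere below)

At (III′) the comb-chart resolvent is the `Ψ̂_S`-conjugate of the rooted block-mean step resolvent (an2's `CombChartTransportLevel`), and the (E) level words
absorb `Ψ̂_S` into the slot transport `𝒯 T := slotPsiS r n T = T + faceWt • faceSum T` on the running tables (road-P2 g55's `CombCubicStepTransport` for the S-slot;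
d1-formalise-leaf-03's `SymCorrectorPair ∕ Rest ∕ LiteralW` for the second-order words — the OWNER's NOTE N-gan24p1-g46-1 (Q1)).  The (α-0) chain at (III′) runs on
the EVEN half `½ • (T + P T)` of the comb-chart towers (the OWNER's `CombTowerEndOfSlots` §5 ∕ `CombEvenTowerAutonomy`, this lineage's `CombChartSlotJunction`).  The
lemmas below say the two structures are compatible: `P (𝒯 T) = 𝒯 (P T)` bondwise, because `faceWt` is a real scalar and `faceSum` a signed finite sum, and `P` is
ℝ-linear.  Hence `𝒯` acts on the even tower by itself (and on the odd tower by itself); what the face parts ARE (the towers' own Ward contact words, block-summed)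
is road-P2 g55's `CombSlotTransportFaceWard` ∕ d1-formalise-leaf-03's `SymCorrectorFaceDiv` — not this file.

## What is proved (generic `d`; kernel-valued bond families `T : Fin (d+1) → Site (d+1) → MKer (d+1) (Fib d)`; any block side `n`, any root `r`)

* §1 `sgnK_trK_slotPsiS` (`P (𝒯 T α x) = 𝒯 (P ∘ T) α x`), `slotPsiS_parity_comm` (as families).
* §2 linearity of `𝒯`: `slotPsiS_add ∕ _smul ∕ _neg ∕ _sub` (the face sum's is d1-formalise-leaf-03's `faceSum_add ∕ _smul`).
* §3 halves: `slotPsiS_evenHalf` ∕ `slotPsiS_oddHalf` (`𝒯 (½ • (T ± P T)) = ½ • (𝒯 T ± P (𝒯 T))` as families) — `𝒯` maps the even (odd) tower to the even (odd) tower.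
* §4 classes preserved: `parityOdd_slotPsiS` (`∀ κ u, trK (T κ u) = −sgnK (T κ u)` ⟹ the same for every `𝒯 T α x`), `parityEven_slotPsiS` (`P = id` preserved likewise).
* §5 the PAIR transport of bi-tables `𝒯₂ S₂ := α x ↦ 𝒯 (𝒯 S₂ α x)` (d1-formalise-leaf-03's `vertex2OfK_conj_psiKS` form): `sgnK_trK_slotPsiS₂`, `slotPsiS₂_evenHalf ∕ _oddHalf` — the even `T₂`-tower is `𝒯₂`-stable; (+ §2's module-valued linearity and `slotPsiS_apply₂`).
WHAT IS NOT HERE: the FACE-SUM side (`faceSum_sgnK_trK`, `faceSum_evenHalf ∕ _oddHalf`, the face sums of the (III′) towers as Ward words) — road-P2 g55's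
`GAN24/CombSlotTransportFaceWard` (INTENT I-gan24p2-g55-3 l.65086, staged 4 minutes before this file; one home per statement = his); any value of a face sum;
anything of (CONV-C).
Unit `b2b-balaban-gan24-formalise-leaf-01` (gen 79); no existing file touched.
-/

open Finset
open scoped BigOperators
open Literature.MathematicalPhysics.QuantumFieldTheory
open Literature.MathematicalPhysics.QuantumFieldTheory.Balaban1983to89
open Literature.MathematicalPhysics.QuantumFieldTheory.Balaban1983to89.Beta
open ExpKernelCalculus (MKer)
open OneStepResolventKernel (Fib)
open AffineAveraging (Site)
open AveragingContours (blk)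
open Summit.QuantumFields.BalabanUV.Beta.TameKernelCalculus (trK)
open Summit.QuantumFields.BalabanUV.Beta.BorderedHessian (sgnK)
open Summit.QuantumFields.BalabanUV.Beta.SymCorrectorFace (faceWt faceSum slotPsiS)
open Summit.QuantumFields.BalabanUV.Beta.SymCorrectorRest (faceSum_add faceSum_smul)
open Summit.QuantumFields.BalabanUV.Beta.GAN24.SecondOrderReadersParity (sgnK_trK_add sgnK_trK_sub sgnK_trK_neg sgnK_trK_smul sgnK_trK_sum
  sgnK_trK_sgnK_trK parityOdd_iff)

namespace Summit.QuantumFields.BalabanUV.Beta.GAN24.SlotTransportParity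

noncomputable section

variable {d : ℕ} (r : Fin (d + 1) → ℕ) (n : ℕ) (T : Fin (d + 1) → Site (d + 1) → MKer (d + 1) (Fib d))

/-! ## §1 The involution passes through the face sum and the slot transport -/

/-- [folklore] **`P` COMMUTES WITH THE SLOT TRANSPORT, BONDWISE**: `sgnK (trK (slotPsiS r n T α x)) = slotPsiS r n (κ u ↦ sgnK (trK (T κ u))) α x`
(`slotPsiS T α x = T α x + faceWt α x • faceSum T (blk x)`, `faceWt` a real scalar). -/
theorem sgnK_trK_slotPsiS (α : Fin (d + 1)) (x : Site (d + 1)) :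
    sgnK (trK (slotPsiS r n T α x)) = slotPsiS r n (fun κ u => sgnK (trK (T κ u))) α x := by
  simp only [SymCorrectorFace.slotPsiS, faceSum, sgnK_trK_add, sgnK_trK_smul, sgnK_trK_sum]

/-- [folklore] **… AS FAMILIES**: `(α x ↦ P (𝒯 T α x)) = 𝒯 (P ∘ T)`. -/
theorem slotPsiS_parity_comm :
    (fun α x => sgnK (trK (slotPsiS r n T α x))) = slotPsiS r n (fun κ u => sgnK (trK (T κ u))) :=
  funext fun α => funext fun x => sgnK_trK_slotPsiS r n T α x

/-! ## §2 Linearity of the slot transport (the face sum's is d1-formalise-leaf-03's `faceSum_add` ∕ `faceSum_smul`) -/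

section Linear

variable {E : Type*} [AddCommGroup E] [Module ℝ E]

/-- [folklore] The slot transport is additive in the family (ANY module-valued bond family: stencils, bi-tables, …). -/
theorem slotPsiS_add (A B : Fin (d + 1) → Site (d + 1) → E) : slotPsiS r n (A + B) = slotPsiS r n A + slotPsiS r n B := by
  funext α x
  simp only [SymCorrectorFace.slotPsiS, Pi.add_apply, faceSum_add, smul_add]
  abel

/-- [folklore] The slot transport is `ℝ`-homogeneous in the family (`faceWt` is a real scalar). -/
theorem slotPsiS_smul (c : ℝ) (A : Fin (d + 1) → Site (d + 1) → E) : slotPsiS r n (c • A) = c • slotPsiS r n A := by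
  funext α x
  simp only [SymCorrectorFace.slotPsiS, Pi.smul_apply, faceSum_smul, smul_add, smul_comm (faceWt r n α x) c]

/-- [folklore] The slot transport of a negated family. -/
theorem slotPsiS_neg (A : Fin (d + 1) → Site (d + 1) → E) : slotPsiS r n (-A) = -slotPsiS r n A := by
  rw [← neg_one_smul ℝ A, slotPsiS_smul, neg_one_smul]

/-- [folklore] The slot transport of a difference. -/
theorem slotPsiS_sub (A B : Fin (d + 1) → Site (d + 1) → E) : slotPsiS r n (A - B) = slotPsiS r n A - slotPsiS r n B := by
  rw [sub_eq_add_neg, slotPsiS_add, slotPsiS_neg, ← sub_eq_add_neg]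

/-- [folklore] **EVALUATION AT THE INNER BOND COMMUTES WITH THE OUTER TRANSPORT** (bi-tables `S₂ : Fin → Site → Fin → Site → E` read as `E`-VALUED-bond-family-valued
bond families): `slotPsiS r n S₂ α x κ u = slotPsiS r n (β y ↦ S₂ β y κ u) α x`. -/
theorem slotPsiS_apply₂ (S₂ : Fin (d + 1) → Site (d + 1) → Fin (d + 1) → Site (d + 1) → E) (α : Fin (d + 1)) (x : Site (d + 1)) (κ : Fin (d + 1))
    (u : Site (d + 1)) : slotPsiS r n S₂ α x κ u = slotPsiS r n (fun β y => S₂ β y κ u) α x := by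
  simp only [SymCorrectorFace.slotPsiS, faceSum, Pi.add_apply, Pi.smul_apply, Finset.sum_apply]

end Linear

/-! ## §3 The even and odd halves -/

/-- [folklore] **THE SLOT TRANSPORT OF THE EVEN HALF IS THE EVEN HALF OF THE SLOT TRANSPORT** (as families):
`𝒯 (κ u ↦ ½ • (T κ u + P (T κ u))) = (α x ↦ ½ • (𝒯 T α x + P (𝒯 T α x)))` — `𝒯` maps the even tower to the even tower. -/
theorem slotPsiS_evenHalf :
    slotPsiS r n (fun κ u => ((1 : ℝ) / 2) • (T κ u + sgnK (trK (T κ u)))) =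
      fun α x => ((1 : ℝ) / 2) • (slotPsiS r n T α x + sgnK (trK (slotPsiS r n T α x))) := by
  have e : (fun κ u => ((1 : ℝ) / 2) • (T κ u + sgnK (trK (T κ u)))) = ((1 : ℝ) / 2) • (T + fun κ u => sgnK (trK (T κ u))) := by
    funext κ u; simp only [Pi.smul_apply, Pi.add_apply]
  rw [e, slotPsiS_smul, slotPsiS_add, ← slotPsiS_parity_comm]
  funext α x
  simp only [Pi.smul_apply, Pi.add_apply]

/-- [folklore] **THE SLOT TRANSPORT OF THE ODD HALF IS THE ODD HALF OF THE SLOT TRANSPORT** (as families). -/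
theorem slotPsiS_oddHalf :
    slotPsiS r n (fun κ u => ((1 : ℝ) / 2) • (T κ u - sgnK (trK (T κ u)))) =
      fun α x => ((1 : ℝ) / 2) • (slotPsiS r n T α x - sgnK (trK (slotPsiS r n T α x))) := by
  have e : (fun κ u => ((1 : ℝ) / 2) • (T κ u - sgnK (trK (T κ u)))) = ((1 : ℝ) / 2) • (T - fun κ u => sgnK (trK (T κ u))) := by
    funext κ u; simp only [Pi.smul_apply, Pi.sub_apply]
  rw [e, slotPsiS_smul, slotPsiS_sub, ← slotPsiS_parity_comm]
  funext α x
  simp only [Pi.smul_apply, Pi.sub_apply]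

/-! ## §4 Row-parity classes are preserved -/

/-- [folklore] **THE SLOT TRANSPORT PRESERVES ROW-PARITY-ODD FAMILIES**: `(∀ κ u, trK (T κ u) = −sgnK (T κ u))` ⟹ `∀ α x, trK (𝒯 T α x) = −sgnK (𝒯 T α x)` —
the (Sp) ∕ (Mp)-type letters of the parity dictionary survive the transport. -/
theorem parityOdd_slotPsiS (hT : ∀ κ u, trK (T κ u) = -sgnK (T κ u)) (α : Fin (d + 1)) (x : Site (d + 1)) :
    trK (slotPsiS r n T α x) = -sgnK (slotPsiS r n T α x) := by
  have h : (fun κ u => sgnK (trK (T κ u))) = -T := funext fun κ => funext fun u => (parityOdd_iff _).1 (hT κ u)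
  rw [parityOdd_iff, sgnK_trK_slotPsiS, h, slotPsiS_neg, Pi.neg_apply, Pi.neg_apply]

/-- [folklore] **THE SLOT TRANSPORT PRESERVES ROW-PARITY-EVEN FAMILIES**: `(∀ κ u, sgnK (trK (T κ u)) = T κ u)` ⟹ `∀ α x, sgnK (trK (𝒯 T α x)) = 𝒯 T α x`. -/
theorem parityEven_slotPsiS (hT : ∀ κ u, sgnK (trK (T κ u)) = T κ u) (α : Fin (d + 1)) (x : Site (d + 1)) :
    sgnK (trK (slotPsiS r n T α x)) = slotPsiS r n T α x := by
  have h : (fun κ u => sgnK (trK (T κ u))) = T := funext fun κ => funext fun u => hT κ u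
  rw [sgnK_trK_slotPsiS, h]


/-! ## §5 The pair (two-slot) transport `𝒯₂ S₂ := α x ↦ 𝒯 (𝒯 S₂ α x)` of bi-tables (the form of d1-formalise-leaf-03's `SymCorrectorPair.vertex2OfK_conj_psiKS`) -/

section Pair

variable (S₂ : Fin (d + 1) → Site (d + 1) → Fin (d + 1) → Site (d + 1) → MKer (d + 1) (Fib d))

/-- [folklore] **`P` COMMUTES WITH THE PAIR TRANSPORT, ENTRYWISE**:
`P (𝒯 (𝒯 S₂ α x) κ u) = 𝒯 (𝒯 (P ∘∘ S₂) α x) κ u` (§1 on the inner slot, `slotPsiS_apply₂` + §1 on the outer slot). -/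
theorem sgnK_trK_slotPsiS₂ (α : Fin (d + 1)) (x : Site (d + 1)) (κ : Fin (d + 1)) (u : Site (d + 1)) :
    sgnK (trK (slotPsiS r n (slotPsiS r n S₂ α x) κ u)) =
      slotPsiS r n (slotPsiS r n (fun β y κ' u' => sgnK (trK (S₂ β y κ' u'))) α x) κ u := by
  have hF : (fun κ' u' => sgnK (trK (slotPsiS r n S₂ α x κ' u'))) = slotPsiS r n (fun β y κ' u' => sgnK (trK (S₂ β y κ' u'))) α x := by
    funext κ' u'
    simp only [slotPsiS_apply₂ r n S₂, slotPsiS_apply₂ r n (fun β y κ' u' => sgnK (trK (S₂ β y κ' u'))), sgnK_trK_slotPsiS]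
  rw [sgnK_trK_slotPsiS, hF]

/-- [folklore] **THE PAIR TRANSPORT OF THE EVEN HALF IS THE EVEN HALF OF THE PAIR TRANSPORT** (bi-tables; entrywise form):
`𝒯 (𝒯 (½ • (S₂ + P∘∘S₂)) α x) κ u = ½ • (𝒯 (𝒯 S₂ α x) κ u + P (𝒯 (𝒯 S₂ α x) κ u))` — the even `T₂`-tower of the (α-0) chain is `𝒯₂`-stable. -/
theorem slotPsiS₂_evenHalf (α : Fin (d + 1)) (x : Site (d + 1)) (κ : Fin (d + 1)) (u : Site (d + 1)) :
    slotPsiS r n (slotPsiS r n (fun β y κ' u' => ((1 : ℝ) / 2) • (S₂ β y κ' u' + sgnK (trK (S₂ β y κ' u')))) α x) κ u =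
      ((1 : ℝ) / 2) • (slotPsiS r n (slotPsiS r n S₂ α x) κ u + sgnK (trK (slotPsiS r n (slotPsiS r n S₂ α x) κ u))) := by
  have e : (fun β y κ' u' => ((1 : ℝ) / 2) • (S₂ β y κ' u' + sgnK (trK (S₂ β y κ' u')))) =
      ((1 : ℝ) / 2) • (S₂ + fun β y κ' u' => sgnK (trK (S₂ β y κ' u'))) := by
    funext β y κ' u'; simp only [Pi.smul_apply, Pi.add_apply]
  rw [e, sgnK_trK_slotPsiS₂]
  simp only [slotPsiS_smul, slotPsiS_add, Pi.smul_apply, Pi.add_apply]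

/-- [folklore] **THE PAIR TRANSPORT OF THE ODD HALF IS THE ODD HALF OF THE PAIR TRANSPORT** (bi-tables; entrywise form). -/
theorem slotPsiS₂_oddHalf (α : Fin (d + 1)) (x : Site (d + 1)) (κ : Fin (d + 1)) (u : Site (d + 1)) :
    slotPsiS r n (slotPsiS r n (fun β y κ' u' => ((1 : ℝ) / 2) • (S₂ β y κ' u' - sgnK (trK (S₂ β y κ' u')))) α x) κ u =
      ((1 : ℝ) / 2) • (slotPsiS r n (slotPsiS r n S₂ α x) κ u - sgnK (trK (slotPsiS r n (slotPsiS r n S₂ α x) κ u))) := by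
  have e : (fun β y κ' u' => ((1 : ℝ) / 2) • (S₂ β y κ' u' - sgnK (trK (S₂ β y κ' u')))) =
      ((1 : ℝ) / 2) • (S₂ - fun β y κ' u' => sgnK (trK (S₂ β y κ' u'))) := by
    funext β y κ' u'; simp only [Pi.smul_apply, Pi.sub_apply]
  rw [e, sgnK_trK_slotPsiS₂]
  simp only [slotPsiS_smul, slotPsiS_sub, Pi.smul_apply, Pi.sub_apply]

end Pair

end

end Summit.QuantumFields.BalabanUV.Beta.GAN24.SlotTransportParity
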